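import Mathlib
import HarnessLib
import HarnessLib.Audit
import Summits.CriticalPhenomena.Statement
import HarnessLib.Audit.Status.Attr

/-!
Route: ClusterRigidity

DORMANT since 2026-08-26T09:04:04Z (reconciler: no traction for 8.4 d (last activity item-evidence-added at 2026-08-17T23:05:48Z); parked, not closed — `ledger route dormant route-CriticalPhenomena-ClusterRigidity --off` to reactivate) — unstaffed, not closed; items shared with open routes are served there. `ledger route dormant <id> --off` reactivates.

# Route ClusterRigidity — compact connected cluster set of self-normalised critical correlators +
rigidity (total disconnectedness) of admissible limits ⇒ the full 3D Ising scaling limit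

It suffices to show X_CR = Reg ∧ Cov ∧ TD ∧ NG for the SELF-NORMALISED rescaled critical correlators
F_δ(n,x) := ρ★(δ)^n ⟨∏ᵢ σ_{⌊xᵢ/δ⌋}⟩⁺_{β_c(3)}, ρ★(δ) := ⟨σ₀σ_{⌊1/δ⌋e₁}⟩_{β_c}^{-1/2} (forced:
F_δ(2;0,e₁) = 1, no renormalisation to
choose), with CLUSTER SET 𝒞 := {S : S = 0 off NonCoincident, and F_{δ_k}(n,·) → S n locally
uniformly on NonCoincident 3 n for all n
along some δ_k → 0⁺ in (0,1]}. Reg (UniformRegularity): on every compact K ⊆ NonCoincident 3 n the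
family {F_δ(n,·)} is uniformly
bounded and uniformly equicontinuous for δ small, and F_δ(2,·) ≥ m_K > 0. Cov
(ClusterPointsMoebius): every S ∈ 𝒞 is Möbius covariant
with some Δ > 0. TD (ClusterSetTotallyDisconnected): 𝒞 is totally disconnected (pointwise topology).
NG (= item stmt-CriticalPhenomena-0636):
every non-degenerate pointwise scaling limit has U₄ ≢ 0. Card realised: rigidity-supplies-uniqueness
(spine). Reg makes 𝒞 non-empty and
compact and — because δ ↦ F_δ is then asymptotically continuous — CONNECTED; a connected subset of a
totally disconnected set is a point,
so F_δ converges along the full filter δ → 0⁺ with no convergence mechanism on the lattice; Cov,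
Reg(c) and NG dress the limit into the
conjunct. TD is the join point of the card's CFT engine (cluster points are σ-families of Ising-like
LOCAL CFTs ∧ such CFT data are
isolated), kept as ONE typed crux until the conformal-block definition it needs lands (Definition
requests).
Lean: `((∀ (n : ℕ) (K : Set (Fin n → EuclideanSpace ℝ (Fin 3))), K ⊆
Literature.Probability.LatticeModels.NonCoincident 3 n → IsCompact K → (∃ M δ₀ : ℝ, 0 < δ₀ ∧ ∀ δ ∈
Set.Ioo 0 δ₀, ∀ x ∈ K, |Literature.Probability.LatticeModels.rescaledCorrelator
(Literature.Probability.LatticeModels.criticalCorr 3) (fun δ : ℝ =>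
(Literature.Probability.LatticeModels.criticalTwoPoint 3 (Pi.single 0 ⌊δ⁻¹⌋)) ^ (-(1/2:ℝ))) n δ x| ≤
M) ∧ (∀ ε : ℝ, 0 < ε → ∃ r δ₀ : ℝ, 0 < r ∧ 0 < δ₀ ∧ ∀ δ ∈ Set.Ioo 0 δ₀, ∀ x ∈ K, ∀ y ∈ K, dist x y <
r → |Literature.Probability.LatticeModels.rescaledCorrelator
(Literature.Probability.LatticeModels.criticalCorr 3) (fun δ : ℝ =>
(Literature.Probability.LatticeModels.criticalTwoPoint 3 (Pi.single 0 ⌊δ⁻¹⌋)) ^ (-(1/2:ℝ))) n δ x -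
Literature.Probability.LatticeModels.rescaledCorrelator
(Literature.Probability.LatticeModels.criticalCorr 3) (fun δ : ℝ =>
(Literature.Probability.LatticeModels.criticalTwoPoint 3 (Pi.single 0 ⌊δ⁻¹⌋)) ^ (-(1/2:ℝ))) n δ y| <
ε)) ∧ (∀ K : Set (Fin 2 → EuclideanSpace ℝ (Fin 3)), K ⊆
Literature.Probability.LatticeModels.NonCoincident 3 2 → IsCompact K → ∃ m δ₀ : ℝ, 0 < m ∧ 0 < δ₀ ∧
∀ δ ∈ Set.Ioo 0 δ₀, ∀ x ∈ K, m ≤ Literature.Probability.LatticeModels.rescaledCorrelator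
(Literature.Probability.LatticeModels.criticalCorr 3) (fun δ : ℝ =>
(Literature.Probability.LatticeModels.criticalTwoPoint 3 (Pi.single 0 ⌊δ⁻¹⌋)) ^ (-(1/2:ℝ))) 2 δ x))
∧ (∀ S : Literature.Probability.LatticeModels.CorrFamily 3, ((∀ n x, x ∉
Literature.Probability.LatticeModels.NonCoincident 3 n → S n x = 0) ∧ ∃ u : ℕ → ℝ, (∀ k, u k ∈
Set.Ioc (0:ℝ) 1) ∧ Filter.Tendsto u Filter.atTop (nhds 0) ∧ ∀ n, TendstoLocallyUniformlyOn (fun k =>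
Literature.Probability.LatticeModels.rescaledCorrelator
(Literature.Probability.LatticeModels.criticalCorr 3) (fun δ : ℝ =>
(Literature.Probability.LatticeModels.criticalTwoPoint 3 (Pi.single 0 ⌊δ⁻¹⌋)) ^ (-(1/2:ℝ))) n (u k))
(S n) Filter.atTop (Literature.Probability.LatticeModels.NonCoincident 3 n)) → ∃ Δ : ℝ, 0 < Δ ∧
Literature.Probability.LatticeModels.IsMoebiusCovariant Δ S) ∧ (IsTotallyDisconnected {S :
Literature.Probability.LatticeModels.CorrFamily 3 | (∀ n x, x ∉
Literature.Probability.LatticeModels.NonCoincident 3 n → S n x = 0) ∧ ∃ u : ℕ → ℝ, (∀ k, u k ∈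
Set.Ioc (0:ℝ) 1) ∧ Filter.Tendsto u Filter.atTop (nhds 0) ∧ ∀ n, TendstoLocallyUniformlyOn (fun k =>
Literature.Probability.LatticeModels.rescaledCorrelator
(Literature.Probability.LatticeModels.criticalCorr 3) (fun δ : ℝ =>
(Literature.Probability.LatticeModels.criticalTwoPoint 3 (Pi.single 0 ⌊δ⁻¹⌋)) ^ (-(1/2:ℝ))) n (u k))
(S n) Filter.atTop (Literature.Probability.LatticeModels.NonCoincident 3 n)}) ∧ (∀ (ρ : ℝ → ℝ) (S :
Literature.Probability.LatticeModels.CorrFamily 3), (∀ δ ∈ Set.Ioc (0:ℝ) 1, 0 < ρ δ) →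
Literature.Probability.LatticeModels.HasPointwiseScalingLimit
(Literature.Probability.LatticeModels.criticalCorr 3) ρ S →
Literature.Probability.LatticeModels.IsNondegenerateTwoPoint S →
Literature.Probability.LatticeModels.HasNontrivialU4 S)`

## Assembly
From Reg: Precompactness (𝒞 ≠ ∅; every mesh sequence has a subsequence converging for all n, limits
normalised) and
AsymptoticContinuity. Standard lemma (to be attached with --supports): in the metrisable space ∏ₙ
C⁰_loc(NonCoincident 3 n) (countably
many sup-seminorms on an exhaustion by compacts) the cluster set of a path with precompact tails and
vanishing increments
(F_{u_k} − F_{v_k} → 0 whenever u_k/v_k → 1) is compact and CONNECTED; the identity to the pointwise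
topology is continuous, so 𝒞 is
connected there too, hence by TD (IsTotallyDisconnected: preconnected subsets are subsingletons) 𝒞 =
{S★}. This metric-space core is
PROVED sorry-free in the planner's scratch file Topology2.lean (namespace ClusterRigidityScratch,
280 lines, lean check rc 0:
`tendsto_of_totallyDisconnected_clusterSet : Precompact F → AsympCont F → IsTotallyDisconnected
(clusterSet F) → ∃ x, Tendsto F (𝓝[>] 0) (𝓝 x)`
for F : ℝ → X, X any metric space, via sequential compactness of the cluster set, eventual
containment in open supersets, a uniform
form of asymptotic continuity, Disjoint.exists_thickenings and a multiplicative chain lemma; to be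
attached as evidence / re-proved
under Theorems with --supports Assembly); what remains is metrising ∏ₙ C⁰_loc(NonCoincident 3 n) and
transport. By the PROVED subsequence
principle Literature.Barriers.CriticalPhenomena.hasPointwiseScalingLimit_of_seq_subseq,
HasPointwiseScalingLimit (criticalCorr 3) ρ★ S★;
ρ★ > 0 on (0,1] from criticalTwoPoint_bounds_holds (PROVED; ⌊1/δ⌋e₁ ≠ 0 for δ ≤ 1);
IsNondegenerateTwoPoint S★ from Reg (c) on
singleton compacts; Cov gives Δ > 0 with IsMoebiusCovariant Δ S★; NG at (ρ★, S★) gives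
HasNontrivialU4 S★ — the six fields of
Literature.Probability.LatticeModels.CritIsing3DConformalLimit = Ising3DConformalLimit. Pattern:
hasConformalLimit_of_compact_of_unique
(same file, proved) with uniqueness replaced by connected-inside-totally-disconnected. Estimated
300–600 Lean lines, Arzelà–Ascoli /
metrisability bookkeeping dominating; no lattice input beyond the two proved facts. The decl-name
form
`UniformRegularity → ClusterPointsMoebius → ClusterSetTotallyDisconnected → NonGaussian →
Ising3DConformalLimit` is Iff.rfl-equal to the
inlined statement (checked in the planner's Gate.lean).

Rationale: WHY THIS LINE. Uniqueness of the scaling limit from RIGIDITY OF THE TARGET instead of a convergence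
mechanism on the lattice (none is known in d = 3:
no RG fixed point at ε = 1, no discrete holomorphicity — item stmt-CriticalPhenomena-0638): the
template is uniqueness of tangent cones /
blow-ups when the moduli of admissible limits is discrete (Allard–Almgren 1981, Simon 1983) and of
ω-limit sets among isolated equilibria —
compactness + connectedness of the limit set + total disconnectedness of where it may lie. Imported
areas: point-set topology (cluster
sets of asymptotically continuous paths), axiomatic CFT / conformal bootstrap for the intended
engine of TD (KosPolandSimmonsDuffinVichi2016,
PolandRychkovVichi2019 §V.B, Rychkov2020 pp. 8–10 'most local CFTs are expected to be isolated'),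
lattice correlation-inequality
technology for Reg (AizenmanDuminilCopinAnnals2021 §5, DuminilcopinPanis2025). Versus the open
routes: IsingCFTData asks the lattice for
the identification INCLUDING convergence (item 0665) and IsingEuclidUpgrade for the full Euclidean
limit (0638); this line asks the
lattice only about SUBSEQUENTIAL limits and manufactures convergence. Versus the in-tree
compactness–UNIQUENESS schema
(Literature.Barriers.CriticalPhenomena.hasConformalLimit_of_compact_of_unique, audit 2026-08-15):
global uniqueness of the target class —
false as soon as the class has two members — is replaced by total disconnectedness, which tolerates
countably or Cantor-many Ising-like
CFTs, at the price of one lattice input that is free under Reg (asymptotic continuity) and the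
forced normalisation ρ★ (which also avoids
the ∀ρ / killing-renormalisation refutations 0663/0666).

RANKED CRUXES. #2 ClusterPointsMoebius (crux) — every cluster point S of the self-normalised family
(S := 0 off NonCoincident; F_{δ_k} → S locally uniformly on NonCoincident 3 n for all n along some
δ_k → 0⁺ in (0,1]) is Möbius covariant with some Δ > 0 (translations, O(3), dilations, unit
inversion). Card item (2) cut down to what the assembly consumes: the (U)-content of
IsingEuclidUpgrade and the isotropy problem, but only SUBSEQUENTIALLY, plus 'every cluster point is
a fixed point of the zoom' (scale covariance); Δ ∈ [1/2,1] is then forced by c‖x‖⁻² ≤ g ≤ C‖x‖⁻¹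
(criticalTwoPoint_bounds_holds) and F(2;0,e₁) = 1. [difficulty: open-problem] (why it might fail: A
cluster point may be scale- but not inversion-covariant (a dimension-2 virial current; excluded only
by MC, Δ_V > 5.0), may keep cubic anisotropy, or may fail scale covariance itself (log-periodic
modulation = RG limit cycle along the zoom); nothing rigorous pins any of the three on ℤ³.)
[DuminilCopinICM2022 §8.1 p.25 and §8.4 p.29, MenesesEtAl2019 (arXiv:1802.02319 §1),
DelamotteTissierWschebor2016 §6, Literature.Barriers.CriticalPhenomena.ScaleCovarianceNotMoebius
(scope caveat (a)),
Summit.CriticalPhenomena.IsingEuclidUpgrade.not_inversionUpgrade_of_euclideanLimit (normalisation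
adopted)]
#3 UniformRegularity (crux) — for every n and compact K ⊆ NonCoincident 3 n: (a) |F_δ(n,x)| ≤ M_K on
K for all δ < δ₀(K); (b) uniform equicontinuity: ∀ε>0 ∃r,δ₀>0 ∀δ<δ₀ ∀x,y∈K, dist x y < r → |F_δ(n,x)
− F_δ(n,y)| < ε; (c) n = 2: F_δ(2,x) ≥ m_K > 0 on K for δ < δ₀. Card item (1) (tightness +
non-degeneracy of cluster points). Engines foreseen: every-scale doubling g(2x) ≍ g(x) and Hölder
regularity of rescaled correlators uniformly in the scale (card
every-scale-regular-multiplicative-fekete D1–D3; ADC21 regular scales), Newman's Gaussian inequality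
|⟨σ_A⟩| ≤ Σ_pairings Π⟨σσ⟩ for (a) at even n ≥ 4, m*(β_c)=0 (PROVED:
spontaneousMagnetization_criticalBeta_eq_zero_holds) + GHS for odd n, Messager–Miracle-Solé
monotonicity for (c). [difficulty: open-problem] (why it might fail: Needs doubling g(2x)≍g(x) and
Hölder continuity of rescaled n-point functions at EVERY scale, uniformly in δ; known on ℤ³:
c‖x‖⁻²≤g≤C‖x‖⁻¹ (ratios up to ~‖x‖) and regular scales only 'in abundance' (ADC21 Thm 5.12); an
infrared-saturated plateau-then-drop profile is not excluded.) [AizenmanDuminilCopinAnnals2021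
(arXiv:1912.07973 §5.6 and Thm 5.12), DuminilcopinPanis2025 (arXiv:2404.05700 Thm 1.5 and Rem 1.9),
Literature.Probability.LatticeModels.criticalTwoPoint_bounds_holds, Newman1975Gaussian,
MessagerMiracleSoleJSP1977]
#4 ClusterSetTotallyDisconnected (crux) — the cluster set 𝒞 of the self-normalised family is totally
disconnected in the pointwise (product) topology of CorrFamily 3 (on 𝒞, compact under Reg, this
coincides with the locally uniform topology; pointwise is the stronger ask otherwise). INTENDED
ENGINE (card items (2)–(4), the route's point, layer 2): 𝒞 ⊆ 𝓘 := σ-correlator families of LOCAL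
unitary ℤ₂-symmetric 3D CFTs with exactly one relevant odd and exactly one relevant non-identity
even scalar and Δ_σ ≤ 1 (lattice side: OS positivity, clustering, covariance and spectrum of cluster
points), and 𝓘 is totally disconnected (CFT side, lattice-blind: 'It is expected that most local
CFTs are isolated. One exception are CFTs with exactly marginal fields of dimension Δ = d … A folk
conjecture says that exactly marginal fields in d ≥ 3 require supersymmetry' — Rychkov2020,
arXiv:2007.14315 p.8, read this session; LOCAL = 'critical points of lattice models with
finite-range interactions', ibid., which is what excludes the non-local long-range arc; an ANALYTIC
isolation theorem for exact solutions of crossing — NOT a finite-Λ positivity certificate, which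
only gives diam ≤ ε(Λ): refuter flag on the card, accepted). Both halves need genuine Dolan–Osborn
blocks (+ mixed σ,ε correlators for the odd gap) to be typed: over the v0 hypothesis structure
ConformalBlocks.IsStandard the blocks B.g are free continuous functions, so GFF_Δ (Δ ∈ [1,3/2)) and
products of GFFs dress up as IsIsingLikeCFT data and isolation is false — hence not filed in v0 form
(Definition requests). Lattice-side partial engine: DimensionPinned (support) fixes the two-point
function on 𝒞. [deps: UniformRegularity] [difficulty: open-problem] (why it might fail: Fails if Δ
is not pinned (g = n^{-2Δ(n)} with slowly drifting Δ(n) gives an arc of pure-power cluster points),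
if the Ising CFT sits on a conformal manifold (Δ_{ε'} = 3; numerics 3.83), or if cluster points
evade the Ising gaps/locality (the long-range arc Δ_σ=(3−s)/2 accumulates at Ising).) [Rychkov2020
(doi:10.5802/crphys.23 pp. 8 and 10), PolandRychkovVichi2019 §V.B p.36,
KosPolandSimmonsDuffinVichi2016 §1, Reehorst2022, PaulosEtAl2016, BehanEtAl2017, BaggioEtAl2018,
Literature.Barriers.CriticalPhenomena.hasConformalLimit_of_compact_of_unique]
#5 NonGaussian (crux) — = item stmt-CriticalPhenomena-0636 verbatim (IsingEuclidUpgrade r4 /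
IsingCFTData r3; expected shared by signature): every non-degenerate pointwise scaling limit of the
renormalised critical correlators on ℤ³ (any ρ > 0 on (0,1]) has U₄ ≢ 0. Used at (ρ★, S★) in the
assembly. [difficulty: open-problem] (why it might fail: No proof that U₄≢0 in d=3: via
U₄=−2⟨σxσy⟩⟨σzσt⟩·P[double-current clusters of {x,y},{z,t} meet], non-Gaussianity needs that
intersection probability to stay >0 at macroscopic separation as δ→0 — unproved for n.n. ℤ³; RP
long-range models on ℤ³ (α<3/2) are Gaussian.) [AizenmanDuminilCopinAnnals2021 (arXiv:1912.07973 Thm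
1.2 and eq. (3.11)), Panis2023Triviality (arXiv:2309.05797 Thm 1.2),
Literature.Barriers.CriticalPhenomena.IsingTrivialityFromDimensionFour,
Literature.Probability.LatticeModels.ursellFour_eq_doubleCurrent]
#9 Precompactness (support) — UniformRegularity → along every sequence δ_k → 0 in (0,1] a
subsequence of (F_{δ_k}) converges locally uniformly on NonCoincident 3 n, for all n simultaneously,
to some S normalised to 0 off NonCoincident (the F_δ are step functions, so run the classical
Arzelà–Ascoli ARGUMENT rather than the theorem: bound (a) + countable dense subset of an exhaustion
of the open set NonCoincident 3 n by compacts + diagonal subsequence over the dense set, the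
exhaustion and n, then asymptotic equicontinuity (b) upgrades pointwise convergence on the dense set
to the uniform Cauchy property on each compact; limits are continuous on NonCoincident and are set
to 0 elsewhere). Gives 𝒞 ≠ ∅ and the input shape of the PROVED subsequence principle
Literature.Barriers.CriticalPhenomena.hasPointwiseScalingLimit_of_seq_subseq. [difficulty:
provable-now] [Literature.Barriers.CriticalPhenomena.hasPointwiseScalingLimit_of_seq_subseq,
BoundedContinuousFunction.arzela_ascoli (Mathlib)]
#9 AsymptoticContinuity (support) — UniformRegularity → for sequences u_k, v_k ∈ (0,1] with u_k → 0
and u_k/v_k → 1, F_{u_k}(n,·) − F_{v_k}(n,·) → 0 uniformly on compacts of NonCoincident 3 n.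
Engine-free proof: the EXACT identity F_{δ'}(n,x) = (ρ★(δ')/ρ★(δ))^n · F_δ(n,(δ/δ')•x) (because
⌊((δ/δ')xᵢ)/δ⌋ = ⌊xᵢ/δ'⌋ coordinatewise), equicontinuity (b), and ρ★(δ)²/ρ★(δ')² = F_δ(2;
0,(δ/δ')e₁) → F_δ(2;0,e₁) = 1 (criticalCorr_two, latticeApprox δ 0 = 0, ρ★² g = 1 with g > 0 by
criticalTwoPoint_bounds_holds). This is what makes 𝒞 connected. [difficulty: provable-now]
[Literature.Probability.LatticeModels.criticalCorr_two,
Literature.Probability.LatticeModels.rescaledCorrelator_apply,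
Literature.Probability.LatticeModels.criticalTwoPoint_bounds_holds]
#9 DimensionPinned (support) — two-sided pure-power bounds c‖x‖^{-(1+η)} ≤ ⟨σ₀σ_x⟩_{β_c(3)} ≤
C‖x‖^{-(1+η)} for some η (HasIsingEtaBounds 3 η). Lattice partial engine for
ClusterSetTotallyDisconnected: under it every scale-covariant cluster point has exponent exactly Δ =
(1+η)/2 (λ^{-2(Δ_S−Δ)} ∈ [c/C, C/c] for all λ > 0 forces Δ_S = Δ), so 𝒞 can only wander at FIXED
two-point function. The log-sense exponent of item 0635 (HasIsingExponentEta) does NOT suffice: g(n)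
= n^{-2a}·exp(c·√(log n)·sin √(log n)) has η = 2a−1 yet a whole interval of pure-power cluster
exponents. = output (D2) of card every-scale-regular-multiplicative-fekete; 'under the power-law
assumption every scale is regular … no unconditional proof' (ADC21 §5.6). [difficulty: open-problem]
[AizenmanDuminilCopinAnnals2021 (arXiv:1912.07973 §5.6), DuminilcopinPanis2025 (arXiv:2404.05700 Thm
1.5), Literature.Probability.LatticeModels.HasIsingEtaBounds]

TWO-LAYER PLAN. Foreseen glued splits (nothing filed now). TD ⇐ ClusterPointsIsingLikeLocalCFT →
IsingLikeCFTIsolation → (continuity of CFT data ↦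
σ-correlators) → ClusterSetTotallyDisconnected, once notion DolanOsbornBlocks (+ mixed-correlator
CFT data) lands — the card's division
of labour: the lattice certifies only CFT-ness of CLUSTER POINTS, the bootstrap side only
discreteness of the target.
ClusterPointsMoebius ⇐ {translation + scale covariance of cluster points ('no RG limit cycle on the
zoom'), O(3) invariance, inversion
covariance} (k = 3). UniformRegularity ⇐ {two-point every-scale doubling + quasi-multiplicativity
(DimensionPinned strength), n-point
equicontinuity from two-point regularity via Gaussian/Lebowitz/GHS inequalities} (k = 2).

KILL CRITERIA. (i) Two distinct Möbius-covariant cluster points exhibited, or TD refuted outright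
(e.g. an exactly marginal ℤ₂-even scalar at the Ising
point established, Δ_{ε'} = 3) ⇒ close `refuted:ClusterSetTotallyDisconnected`; the mechanism has no
fallback inside this route (a
Łojasiewicz/Lyapunov monotone quantity is a different route: cards zoom-flow-lyapunov-existence,
rg-gradient-flow-lojasiewicz).
(ii) UniformRegularity refuted (a sequence of scales with unbounded doubling ratio at β_c(3)) ⇒
pivot: restate Reg and 𝒞 along the
regular scales of ADC21 Thm 5.12 only; if that cannot reach the full filter, close. (iii)
ClusterPointsMoebius refuted by a scale- but not
inversion-covariant cluster point ⇒ the conjunct itself is in doubt (shared fate with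
IsingEuclidUpgrade (U)). (iv) Definition request
declined, or isolation shown to be EQUIVALENT to 'the island shrinks to a point at infinite
derivative order' with no analytic handle ⇒
TD keeps only the lattice partial engine DimensionPinned ⇒ dormant. NonGaussian refuted ⇒ the
conjunct is false for every route.

NOT DECOMPOSED YET. The CFT split of TD (needs definitions; Two-layer plan) — deliberately ONE typed
crux now. OS positivity and clustering of cluster
points (closed conditions, expected cheap given Reg; filed with the split). The spectral transfer
'exactly one relevant odd and one
relevant even scalar' from the (β,h)-codimension of criticality (no known mechanism; LOAD-BEARING:
without the odd gap / locality the
long-range arc Δ_σ = (3−s)/2, s ∈ (3/2, 2−η_SR), of reflection-positive, conformal, non-Gaussian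
theories — PaulosEtAl2016,
BehanEtAl2017 — accumulates at the Ising point and 𝓘 is not totally disconnected there; its second
relevant odd scalar (φ³ with Δ_φ + Δ_{φ³} = d exactly, PaulosEtAl2016 arXiv:1509.00008 p.9; the
field χ of
BehanEtAl2017, arXiv:1703.05325 p.4: '[χ] = (d+s)/2 … the dimension of χ should appear among' the
ℤ₂-odd scalar dimensions), of
dimension (3+s)/2 < 3, and the absence of a local stress tensor ('a conformal field theory without a
local stress tensor operator, with
critical exponents varying continuously as functions of s', ibid. p.2; PaulosEtAl2016 p.14) are what
exclude it; regimes and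
Δ_φ = (d−s)/2 unrenormalised: ibid. p.3). Locality (a Δ = 3, ℓ = 2 primary in σ×σ) of cluster
points. The
topological lemma and the Arzelà–Ascoli glue (ride with --supports Assembly). Constants in Reg. A
negative item ¬TD (staffed only if a
refuter asks).

CHEAPEST FALSIFIER. (a) Lookup: is there ANY analytic (non-numerical) local-uniqueness /
implicit-function statement for exact solutions of the mixed σ,ε
crossing system under the Ising gap assumptions? PolandRychkovVichi2019 §V.B p.36 lists 'would the
island continue to shrink' as open;
Reehorst2022 bounds data INSIDE the island rigorously but does not discretise it; Rychkov2020 p.8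
states isolation as expectation. If the
honest answer is 'isolation ⇔ island-shrinking at Λ = ∞ and nothing weaker is in reach', TD's CFT
engine is an open problem with no
foothold and staffing should go to Reg / Cov / DimensionPinned only. (b) Typing probe run this
session: over v0 IsIsingLikeCFT the
isolation statement is false (free B.g dresses GFF_Δ, Δ ∈ [1,3/2), and φ·ψ products of GFFs as
Ising-like data) — hence NOT filed in v0
form. (c) For Reg: refuter note g3-2 on item 0667 (profiles compatible with GKS/Simon–Lieb/MMS/RP
having unbounded doubling ratios) shows
Reg is not a consequence of in-tree inequalities; a Monte-Carlo look at g(2n)/g(n) at β_c(3), n ≤ 64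
(expected → 2^{−1.036} ≈ 0.488) is
cheap corroboration, not a refutation.

NUMBERS. Δ_σ = 0.5181489(10), Δ_ε = 1.412625(10) (KosPolandSimmonsDuffinVichi2016 §1); Δ_{ε'} ≈
3.83, Δ_{σ'} ≈ 5.29 (PolandRychkovVichi2019 §V.B
table) — isolation margin |Δ_{ε'} − 3| ≈ 0.83; rigorous window for cluster exponents Δ ∈ [1/2, 1]
(criticalTwoPoint_bounds_holds:
c‖x‖⁻² ≤ g ≤ C‖x‖⁻¹ on ℤ³; η ≤ 1/2 if it exists, DuminilcopinPanis2025 Thm 1.5); long-range arc Δ_σ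
= (3−s)/2 ∈ (0.518, 0.75) for
s ∈ (3/2, s*), s* = 2 − η_SR ≈ 1.964 (PaulosEtAl2016 §1, BehanEtAl2017); 3D conformal manifolds do
exist with N = 2 SUSY (BaggioEtAl2018)
— extra relevant scalars, outside 𝓘. Items at open: 8 statements (4 crux, 3 support, 1 assembly) + 1
definition request.

DEFINITION REQUESTS. (1) notion DolanOsbornBlocks (topic Literature/Probability/LatticeModels;
strengthening ConformalBlocks.IsStandard of
ConformalBootstrap.lean): `ConformalBlocks.IsDolanOsborn (B : ConformalBlocks 3) : Prop` — B.g Δ ℓ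
is THE d = 3 four-point block of
identical external scalars: eigenfunction of the quadratic conformal Casimir with eigenvalue Δ(Δ−3)
+ ℓ(ℓ+1) on the square z, z̄ ∈ (0,1),
normalised by the radial small-r behaviour r^Δ·P_ℓ(cos θ) (Dolan–Osborn, Nucl. Phys. B 678 (2004)
§2; Hogervorst–Rychkov radial
coordinates), with IsDolanOsborn → IsStandard proved. (2) flagged, not filed: CFTData v1 with mixed
scalar correlators ⟨σσεε⟩, ⟨σεσε⟩,
so that the ODD-sector gap of IsIsingLikeCFT constrains the data (needed to exclude the long-range
arc). Without (1)(+(2)) the CFT split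
of ClusterSetTotallyDisconnected cannot be typed faithfully; (1) is filed with `ledger workitem add
--kind definition --notion
DolanOsbornBlocks --for <ClusterSetTotallyDisconnected item>`.

Novelty: Searches (2026-08-15): the card's audited searches (crossref 'rigorous conformal bootstrap …
isolated island 3d Ising uniqueness' →
Reehorst2022 doi:10.1007/jhep09(2022)177, Rychkov2020 doi:10.5802/crphys.23; lit vsearch 'uniqueness
of the scaling limit from isolation
of the bootstrap island' → 0) + this session: `lit frontier CriticalPhenomena --since 2020` (30
rows: SLE/CLE/lace/percolation, no
lattice-to-CFT uniqueness work); `lit bridges CriticalPhenomena --cross any` (30 rows, none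
relevant); `lit search --source crossref
"long-range Ising model conformal invariance"` (8 rows → PaulosEtAl2016
doi:10.1016/j.nuclphysb.2015.10.018, DelamotteTissierWschebor2016);
`lit search --source crossref "crossover long-range short-range Behan Rastelli Rychkov Zan"` (→
BehanEtAl2017 doi:10.1088/1751-8121/aa8099
and PRL doi:10.1103/physrevlett.118.241601); `lit search --source crossref "decoding a
three-dimensional conformal manifold"` (→
BaggioEtAl2018 doi:10.1007/jhep02(2018)062); `lit galaxy search "island shrinks to a point" --star
all` and `"no exactly marginal" --star
pdf` (0 hits); local lit index daemon unreachable and openalex/arXiv/S2 rate-limited this session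
(recorded, not worked around). In tree:
Literature.Barriers.CriticalPhenomena.hasConformalLimit_of_compact_of_unique /
hasConformalLimit_of_compact_of_bootstrapUnique (audit
2026-08-15: compactness + UNIQUENESS schema with proved glue).
Nearest prior art found: Rychkov2020 (doi:10.5802/crphys.23) p.8 'most local CFTs are  [refs: 10.1007/jhep09(2022, 10.5802/crphys.23, 10.1016/j.nuclphysb.2015.10.018, 10.1088/1751-8121/aa8099, 10.1103/physrevlett.118.241601, 10.1007/jhep02(2018, doi:10.1007/jhep09, doi:10.5802/crphys.23, doi:10.1016/j.nuclphysb.2015.10.018, doi:10.1088/1751-8121/aa8099, doi:10.1103/physrevlett.118.241601, doi:10.1007/jhep02, Reehorst2022, Rychkov2020, PaulosEtAl2016, DelamotteTissierWschebor2016, BehanEtAl]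

Barriers (technique_class: cluster-set-rigidity, cft-axiomatics, correlation-inequality): - technique_class: cluster-set-rigidity, cft-axiomatics, correlation-inequality
- Literature.Barriers.CriticalPhenomena.BootstrapLatticeBlindness: respected to the letter — no step
is lattice-blind: Reg, Cov, Precompactness, AsymptoticContinuity, DimensionPinned are statements
about criticalCorr 3; the only lattice-blind input foreseen (isolation of Ising-like CFT data, layer
2 of TD) enters conjoined with the lattice statement 'cluster points ∈ 𝓘' — evasion schema (ii) of
the barrier's own audit (hasConformalLimit_of_compact_of_unique), with uniqueness weakened to total
disconnectedness.
- Literature.Barriers.CriticalPhenomena.BootstrapLatticeBlindnessNarrow: evaded by construction —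
the narrow form blocks exactly conclusions about criticalCorr 3 that would hold verbatim for every G
: LatticeCorrFamily 3 (LatticeBlind Φ); every item here quantifies over cluster points / regularity
OF criticalCorr 3 and is false for the zero family (e.g. Reg(c) and F(2;0,e₁)=1 fail for G = 0), so
none is lattice-blind; the foreseen CFT-side isolation theorem is used only conjoined with 'cluster
points of criticalCorr 3 lie in 𝓘' — 'a CFT-side theorem combined with one hypothesis on G is never
in the class' (the barrier's own wording), i.e. its evasion schema (ii) with uniqueness weakened to
total disconnectedness.
- Literature.Barriers.CriticalPhenomena.ScaleCovarianceNotMoebius: contained, not evaded: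
ClusterPointsMoebius carries the Ising-specific hypothesis 'S is a cluster point of the res

History (route lifecycle, newest last):
- 2026-08-26T09:04:04Z · DORMANT — reconciler: no traction for 8.4 d (last activity item-evidence-added at 2026-08-17T23:05:48Z); parked, not closed — `ledger route dormant route-CriticalPhenomen (operator:999:2849732)

sub-problem: Ising3DConformalLimit · status: dormant · opened planner-plancard-CriticalPhenomena-Ising3DCon-749f5edb-0 2026-08-15T11:34:46Z · rev 2 · ledger route-CriticalPhenomena-ClusterRigidity
GENERATED by the gate from the ledger (D-0016/17). Provers cite these decls: `theorem foo : Summit.CriticalPhenomena.Ising3DConformalLimit.Theses.ClusterRigidity.<Decl> := …` in Summits/CriticalPhenomena/Ising3DConformalLimit/Theorems/<Name>.lean.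
-/

namespace Summit.CriticalPhenomena.Ising3DConformalLimit.Theses.ClusterRigidity

open scoped BigOperators Topology Manifold Classical MeasureTheory ProbabilityTheory Matrix InnerProductSpace ComplexConjugate ContinuousMap
open Filter Set Function TopologicalSpace MeasureTheory

attribute [summit_statement] _root_.Ising3DConformalLimit

/-- item stmt-CriticalPhenomena-4657 · crux · rank 2 · open · by planner
why it might fail: Live content = O(3)-invariance + unit-inversion covariance of SUBSEQUENTIAL limits (translation/scale parts free under Reg∧TD): a cluster point may keep cubic anisotropy, or be scale- but not inversion-covariant (dimension-2 virial current; excluded only by MC, Δ_V>5.0); nothing rigorous on ℤ³.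
sources: DuminilCopinICM2022 (arXiv:2208.00864 §8.1 p.25, §8.4 p.29: open on ℤ³), MenesesEtAl2019 (arXiv:1802.02319 §1: virial current, Δ_V>5.0 by MC), DelamotteTissierWschebor2016 (arXiv:1501.01776 §6), Literature.Barriers.CriticalPhenomena.ScaleCovarianceNotMoebius (scope caveat (a); witnessFamily_not_isMoebiusCovariant), Summit.CriticalPhenomena.IsingEuclidUpgrade.not_inversionUpgrade_of_euclideanLimit (normalisation S=0 off NonCoincident adopted)
[crux] every cluster point S of the self-normalised family (S := 0 off NonCoincident; F_{δ_k} → S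
locally uniformly on NonCoincident 3 n for all n along some δ_k → 0⁺ in (0,1]) is Möbius covariant
with some Δ > 0 (translations, O(3), dilations, unit inversion). Card item (2) cut down to what the
assembly consumes: the (U)-content of IsingEuclidUpgrade and the isotropy problem, but only
SUBSEQUENTIALLY, plus 'every cluster point is a fixed point of the zoom' (scale covariance); Δ ∈
[1/2,1] is then forced by c‖x‖⁻² ≤ g ≤ C‖x‖⁻¹ (criticalTwoPoint_bounds_holds) and F(2;0,e₁) = 1.
[difficulty: open-problem] -/
@[route_item "route-CriticalPhenomena-ClusterRigidity", crux]
def ClusterPointsMoebius : Prop :=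
  ∀ S : Literature.Probability.LatticeModels.CorrFamily 3, ((∀ n x, x ∉ Literature.Probability.LatticeModels.NonCoincident 3 n → S n x = 0) ∧ ∃ u : ℕ → ℝ, (∀ k, u k ∈ Set.Ioc (0:ℝ) 1) ∧ Filter.Tendsto u Filter.atTop (nhds 0) ∧ ∀ n, TendstoLocallyUniformlyOn (fun k => Literature.Probability.LatticeModels.rescaledCorrelator (Literature.Probability.LatticeModels.criticalCorr 3) (fun δ : ℝ => (Literature.Probability.LatticeModels.criticalTwoPoint 3 (Pi.single 0 ⌊δ⁻¹⌋)) ^ (-(1/2:ℝ))) n (u k)) (S n) Filter.atTop (Literature.Probability.LatticeModels.NonCoincident 3 n)) → ∃ Δ : ℝ, 0 < Δ ∧ Literature.Probability.LatticeModels.IsMoebiusCovariant Δ S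

/-- item stmt-CriticalPhenomena-4658 · crux · rank 3 · open · by planner
why it might fail: Needs doubling g(2x)≍g(x) and Lipschitz regularity (ADC21 Def 5.11 P1–P2) at EVERY scale, uniformly in δ; in tree only c‖x‖⁻²≤g≤C‖x‖⁻¹ (so F_δ(2;0,x)≤(C/c)‖x‖⁻¹δ⁻¹, no uniform bound) and regular scales only 'in abundance' (ADC21 Thm 5.12); a plateau-then-drop profile is compatible with GKS/MMS/RP.
sources: AizenmanDuminilCopinAnnals2021 (arXiv:1912.07973 §5.6 Def 5.11, Thm 5.12; p.20: 'under the power-law assumption every scale is regular … we do not have an unconditional proof'), DuminilcopinPanis2025 (arXiv:2404.05700 Thm 1.5), Literature.Probability.LatticeModels.criticalTwoPoint_bounds_holds, Newman1975Gaussian, MessagerMiracleSoleJSP1977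
[crux] for every n and compact K ⊆ NonCoincident 3 n: (a) |F_δ(n,x)| ≤ M_K on K for all δ < δ₀(K);
(b) uniform equicontinuity: ∀ε>0 ∃r,δ₀>0 ∀δ<δ₀ ∀x,y∈K, dist x y < r → |F_δ(n,x) − F_δ(n,y)| < ε; (c)
n = 2: F_δ(2,x) ≥ m_K > 0 on K for δ < δ₀. Card item (1) (tightness + non-degeneracy of cluster
points). Engines foreseen: every-scale doubling g(2x) ≍ g(x) and Hölder regularity of rescaled
correlators uniformly in the scale (card every-scale-regular-multiplicative-fekete D1–D3; ADC21
regular scales), Newman's Gaussian inequality |⟨σ_A⟩| ≤ Σ_pairings Π⟨σσ⟩ for (a) at even n ≥ 4,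
m*(β_c)=0 (PROVED: spontaneousMagnetization_criticalBeta_eq_zero_holds) + GHS for odd n,
Messager–Miracle-Solé monotonicity for (c). [difficulty: open-problem] -/
@[route_item "route-CriticalPhenomena-ClusterRigidity", crux]
def UniformRegularity : Prop :=
  (∀ (n : ℕ) (K : Set (Fin n → EuclideanSpace ℝ (Fin 3))), K ⊆ Literature.Probability.LatticeModels.NonCoincident 3 n → IsCompact K → (∃ M δ₀ : ℝ, 0 < δ₀ ∧ ∀ δ ∈ Set.Ioo 0 δ₀, ∀ x ∈ K, |Literature.Probability.LatticeModels.rescaledCorrelator (Literature.Probability.LatticeModels.criticalCorr 3) (fun δ : ℝ => (Literature.Probability.LatticeModels.criticalTwoPoint 3 (Pi.single 0 ⌊δ⁻¹⌋)) ^ (-(1/2:ℝ))) n δ x| ≤ M) ∧ (∀ ε : ℝ, 0 < ε → ∃ r δ₀ : ℝ, 0 < r ∧ 0 < δ₀ ∧ ∀ δ ∈ Set.Ioo 0 δ₀, ∀ x ∈ K, ∀ y ∈ K, dist x y < r → |Literature.Probability.LatticeModels.rescaledCorrelator (Literature.Probability.LatticeModels.criticalCorr 3) (fun δ : ℝ =>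 (Literature.Probability.LatticeModels.criticalTwoPoint 3 (Pi.single 0 ⌊δ⁻¹⌋)) ^ (-(1/2:ℝ))) n δ x - Literature.Probability.LatticeModels.rescaledCorrelator (Literature.Probability.LatticeModels.criticalCorr 3) (fun δ : ℝ => (Literature.Probability.LatticeModels.criticalTwoPoint 3 (Pi.single 0 ⌊δ⁻¹⌋)) ^ (-(1/2:ℝ))) n δ y| < ε)) ∧ (∀ K : Set (Fin 2 → EuclideanSpace ℝ (Fin 3)), K ⊆ Literature.Probability.LatticeModels.NonCoincident 3 2 → IsCompact K → ∃ m δ₀ : ℝ, 0 < m ∧ 0 < δ₀ ∧ ∀ δ ∈ Set.Ioo 0 δ₀, ∀ x ∈ K, m ≤ Literature.Probability.LatticeModels.rescaledCorrelator (Literature.Probability.LatticeModels.criticalCorr 3) (fun δ : ℝ => (Literature.Probability.LatticeModels.criticalTwoPoint 3 (Pi.single 0 ⌊δ⁻¹⌋)) ^ (-(1/2:ℝ))) 2 δ x)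

/-- item stmt-CriticalPhenomena-4659 · crux · rank 4 · open · by planner
why it might fail: Under Reg, TD ⇔ 𝒞 singleton ⇔ full convergence of F^{ρ★}_δ (the whole existence problem). Fails if Δ drifts (g=n^{-2Δ(n)} slowly varying ⇒ arc of pure-power cluster points), if Ising sits on a conformal manifold (Δ_{ε'}=3; numerics 3.83), or if cluster points evade locality (long-range arc).
sources: Rychkov2020 (arXiv:2007.14315 / doi:10.5802/crphys.23 pp. 8, 10: isolation of local CFTs is an expectation, not a theorem), PolandRychkovVichi2019 (arXiv:1805.04405 §V.B p.36: island shrinking open), KosPolandSimmonsDuffinVichi2016 (arXiv:1603.04436 §1), Reehorst2022 (arXiv:2111.12093), PaulosEtAl2016 (arXiv:1509.00008), BehanEtAl2017 (arXiv:1703.05325)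
[crux] the cluster set 𝒞 of the self-normalised family is totally disconnected in the pointwise
(product) topology of CorrFamily 3 (on 𝒞, compact under Reg, this coincides with the locally uniform
topology; pointwise is the stronger ask otherwise). INTENDED ENGINE (card items (2)–(4), the route's
point, layer 2): 𝒞 ⊆ 𝓘 := σ-correlator families of LOCAL unitary ℤ₂-symmetric 3D CFTs with exactly
one relevant odd and exactly one relevant non-identity even scalar and Δ_σ ≤ 1 (lattice side: OS
positivity, clustering, covariance and spectrum of cluster points), and 𝓘 is totally disconnected
(CFT side, lattice-blind: 'It is expected that most local CFTs are isolated. One exception are CFTs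
with exactly marginal fields of dimension Δ = d … A folk conjecture says that exactly marginal
fields in d ≥ 3 require supersymmetry' — Rychkov2020, arXiv:2007.14315 p.8, read this session; LOCAL
= 'critical points of lattice models with finite-range interactions', ibid., which is what excludes
the non-local long-range arc; an ANALYTIC isolation theorem for exact solutions of crossing — NOT a
finite-Λ positivity certificate, which only gives diam ≤ ε(Λ): refuter flag on the card, accepted).
Both halves -/
@[route_item "route-CriticalPhenomena-ClusterRigidity", crux]
def ClusterSetTotallyDisconnected : Prop :=
  IsTotallyDisconnected {S : Literature.Probability.LatticeModels.CorrFamily 3 | (∀ n x, x ∉ Literature.Probability.LatticeModels.NonCoincident 3 n → S n x = 0) ∧ ∃ u : ℕ → ℝ, (∀ k, u k ∈ Set.Ioc (0:ℝ) 1) ∧ Filter.Tendsto u Filter.atTop (nhds 0) ∧ ∀ n, TendstoLocallyUniformlyOn (fun k => Literature.Probability.LatticeModels.rescaledCorrelator (Literature.Probability.LatticeModels.criticalCorr 3) (fun δ : ℝ => (Literature.Probability.LatticeModels.criticalTwoPoint 3 (Pi.single 0 ⌊δ⁻¹⌋)) ^ (-(1/2:ℝ))) n (u k)) (S n) Filter.atTop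 (Literature.Probability.LatticeModels.NonCoincident 3 n)}

/-- item stmt-CriticalPhenomena-0636 · crux · rank 5 · open · by planner
why it might fail: No proof that U₄≢0 in d=3: by U₄=−2⟨σxσy⟩⟨σzσt⟩·P[double-current clusters of {x,y},{z,t} meet] (Aizenman 1982; ADC21 eq. (3.11)) non-Gaussianity needs the intersection probability to stay >0 at macroscopic separation as δ→0 — unproved for n.n. ℤ³; d≥4 and RP long-range α<3/2 on ℤ³ are Gaussian.
sources: AizenmanDuminilCopinAnnals2021 (arXiv:1912.07973 Thm 1.2, eq. (3.11)), Aizenman1982 (CMP 86, Prop 5.1), Panis2023Triviality (arXiv:2309.05797 Thm 1.2), Literature.Barriers.CriticalPhenomena.IsingTrivialityFromDimensionFour, Literature.Probability.LatticeModels.ursellFour_eq_doubleCurrent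
Crux r4 (non-triviality in d=3): every non-degenerate pointwise scaling limit S of the renormalised
critical Ising correlators on Z^3 has connected four-point function U4 ≢ 0 on non-coincident
configurations. Intended tool: the random-current identity U4(x,y,z,t) =
−2⟨σxσy⟩⟨σzσt⟩·P^{xy,zt}[C_{n1+n2}(x) ∩ C_{n1+n2}(z) ≠ ∅] (Aizenman 1982; ADC2021 arXiv:1912.07973
eq. (3.11)): non-Gaussianity ⇔ the intersection probability of the two double-current clusters at
macroscopic separation does not vanish as δ → 0. Contrast: for d ≥ 4 every such limit IS Gaussian
(Literature.Probability.LatticeModels.highDim_triviality). Its negation refutes the conjunct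
Ising3DConformalLimit itself. -/
@[route_item "route-CriticalPhenomena-ClusterRigidity", crux]
def NonGaussian : Prop :=
  ∀ (ρ : ℝ → ℝ) (S : Literature.Probability.LatticeModels.CorrFamily 3), (∀ δ ∈ Set.Ioc (0:ℝ) 1, 0 < ρ δ) → Literature.Probability.LatticeModels.HasPointwiseScalingLimit (Literature.Probability.LatticeModels.criticalCorr 3) ρ S → Literature.Probability.LatticeModels.IsNondegenerateTwoPoint S → Literature.Probability.LatticeModels.HasNontrivialU4 S

/-- item stmt-CriticalPhenomena-4660 · support · rank 9 · open · by planner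
sources: Literature.Barriers.CriticalPhenomena.hasPointwiseScalingLimit_of_seq_subseq, BoundedContinuousFunction.arzela_ascoli (Mathlib)
[support] UniformRegularity → along every sequence δ_k → 0 in (0,1] a subsequence of (F_{δ_k})
converges locally uniformly on NonCoincident 3 n, for all n simultaneously, to some S normalised to
0 off NonCoincident (the F_δ are step functions, so run the classical Arzelà–Ascoli ARGUMENT rather
than the theorem: bound (a) + countable dense subset of an exhaustion of the open set NonCoincident
3 n by compacts + diagonal subsequence over the dense set, the exhaustion and n, then asymptotic
equicontinuity (b) upgrades pointwise convergence on the dense set to the uniform Cauchy property on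
each compact; limits are continuous on NonCoincident and are set to 0 elsewhere). Gives 𝒞 ≠ ∅ and
the input shape of the PROVED subsequence principle
Literature.Barriers.CriticalPhenomena.hasPointwiseScalingLimit_of_seq_subseq. [difficulty:
provable-now] -/
@[route_item "route-CriticalPhenomena-ClusterRigidity", crux]
def Precompactness : Prop :=
  ((∀ (n : ℕ) (K : Set (Fin n → EuclideanSpace ℝ (Fin 3))), K ⊆ Literature.Probability.LatticeModels.NonCoincident 3 n → IsCompact K → (∃ M δ₀ : ℝ, 0 < δ₀ ∧ ∀ δ ∈ Set.Ioo 0 δ₀, ∀ x ∈ K, |Literature.Probability.LatticeModels.rescaledCorrelator (Literature.Probability.LatticeModels.criticalCorr 3) (fun δ : ℝ => (Literature.Probability.LatticeModels.criticalTwoPoint 3 (Pi.single 0 ⌊δ⁻¹⌋)) ^ (-(1/2:ℝ))) n δ x| ≤ M) ∧ (∀ ε : ℝ, 0 < ε → ∃ r δ₀ : ℝ, 0 < r ∧ 0 < δ₀ ∧ ∀ δ ∈ Set.Ioo 0 δ₀, ∀ x ∈ K, ∀ y ∈ K, dist x y < r → |Literature.Probability.LatticeModels.rescaledCorrelator (Literature.Probability.LatticeModels.criticalCorr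 3) (fun δ : ℝ => (Literature.Probability.LatticeModels.criticalTwoPoint 3 (Pi.single 0 ⌊δ⁻¹⌋)) ^ (-(1/2:ℝ))) n δ x - Literature.Probability.LatticeModels.rescaledCorrelator (Literature.Probability.LatticeModels.criticalCorr 3) (fun δ : ℝ => (Literature.Probability.LatticeModels.criticalTwoPoint 3 (Pi.single 0 ⌊δ⁻¹⌋)) ^ (-(1/2:ℝ))) n δ y| < ε)) ∧ (∀ K : Set (Fin 2 → EuclideanSpace ℝ (Fin 3)), K ⊆ Literature.Probability.LatticeModels.NonCoincident 3 2 → IsCompact K → ∃ m δ₀ : ℝ, 0 < m ∧ 0 < δ₀ ∧ ∀ δ ∈ Set.Ioo 0 δ₀, ∀ x ∈ K, m ≤ Literature.Probability.LatticeModels.rescaledCorrelator (Literature.Probability.LatticeModels.criticalCorr 3) (fun δ : ℝ => (Literature.Probability.LatticeModels.criticalTwoPoint 3 (Pi.single 0 ⌊δ⁻¹⌋)) ^ (-(1/2:ℝ))) 2 δ x)) → ∀ u : ℕ → ℝ, (∀ k, u k ∈ Set.Ioc (0:ℝ) 1) → Filter.Tendsto u Filter.atTop (nhds 0) → ∃ (φ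 : ℕ → ℕ) (S : Literature.Probability.LatticeModels.CorrFamily 3), StrictMono φ ∧ (∀ n x, x ∉ Literature.Probability.LatticeModels.NonCoincident 3 n → S n x = 0) ∧ ∀ n, TendstoLocallyUniformlyOn (fun k => Literature.Probability.LatticeModels.rescaledCorrelator (Literature.Probability.LatticeModels.criticalCorr 3) (fun δ : ℝ => (Literature.Probability.LatticeModels.criticalTwoPoint 3 (Pi.single 0 ⌊δ⁻¹⌋)) ^ (-(1/2:ℝ))) n (u (φ k))) (S n) Filter.atTop (Literature.Probability.LatticeModels.NonCoincident 3 n)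

/-- item stmt-CriticalPhenomena-4661 · support · rank 9 · open · by planner
sources: Literature.Probability.LatticeModels.criticalCorr_two, Literature.Probability.LatticeModels.rescaledCorrelator_apply, Literature.Probability.LatticeModels.criticalTwoPoint_bounds_holds
[support] UniformRegularity → for sequences u_k, v_k ∈ (0,1] with u_k → 0 and u_k/v_k → 1,
F_{u_k}(n,·) − F_{v_k}(n,·) → 0 uniformly on compacts of NonCoincident 3 n. Engine-free proof: the
EXACT identity F_{δ'}(n,x) = (ρ★(δ')/ρ★(δ))^n · F_δ(n,(δ/δ')•x) (because ⌊((δ/δ')xᵢ)/δ⌋ = ⌊xᵢ/δ'⌋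
coordinatewise), equicontinuity (b), and ρ★(δ)²/ρ★(δ')² = F_δ(2; 0,(δ/δ')e₁) → F_δ(2;0,e₁) = 1
(criticalCorr_two, latticeApprox δ 0 = 0, ρ★² g = 1 with g > 0 by criticalTwoPoint_bounds_holds).
This is what makes 𝒞 connected. [difficulty: provable-now] -/
@[route_item "route-CriticalPhenomena-ClusterRigidity", crux]
def AsymptoticContinuity : Prop :=
  ((∀ (n : ℕ) (K : Set (Fin n → EuclideanSpace ℝ (Fin 3))), K ⊆ Literature.Probability.LatticeModels.NonCoincident 3 n → IsCompact K → (∃ M δ₀ : ℝ, 0 < δ₀ ∧ ∀ δ ∈ Set.Ioo 0 δ₀, ∀ x ∈ K, |Literature.Probability.LatticeModels.rescaledCorrelator (Literature.Probability.LatticeModels.criticalCorr 3) (fun δ : ℝ => (Literature.Probability.LatticeModels.criticalTwoPoint 3 (Pi.single 0 ⌊δ⁻¹⌋)) ^ (-(1/2:ℝ))) n δ x| ≤ M) ∧ (∀ ε : ℝ, 0 < ε → ∃ r δ₀ : ℝ, 0 < r ∧ 0 < δ₀ ∧ ∀ δ ∈ Set.Ioo 0 δ₀, ∀ x ∈ K,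 ∀ y ∈ K, dist x y < r → |Literature.Probability.LatticeModels.rescaledCorrelator (Literature.Probability.LatticeModels.criticalCorr 3) (fun δ : ℝ => (Literature.Probability.LatticeModels.criticalTwoPoint 3 (Pi.single 0 ⌊δ⁻¹⌋)) ^ (-(1/2:ℝ))) n δ x - Literature.Probability.LatticeModels.rescaledCorrelator (Literature.Probability.LatticeModels.criticalCorr 3) (fun δ : ℝ => (Literature.Probability.LatticeModels.criticalTwoPoint 3 (Pi.single 0 ⌊δ⁻¹⌋)) ^ (-(1/2:ℝ))) n δ y| < ε)) ∧ (∀ K : Set (Fin 2 → EuclideanSpace ℝ (Fin 3)), K ⊆ Literature.Probability.LatticeModels.NonCoincident 3 2 → IsCompact K → ∃ m δ₀ : ℝ, 0 < m ∧ 0 < δ₀ ∧ ∀ δ ∈ Set.Ioo 0 δ₀, ∀ x ∈ K, m ≤ Literature.Probability.LatticeModels.rescaledCorrelator (Literature.Probability.LatticeModels.criticalCorr 3) (fun δ : ℝ => (Literature.Probability.LatticeModels.criticalTwoPoint 3 (Pi.single 0 ⌊δ⁻¹⌋)) ^ (-(1/2:ℝ))) 2 δ x)) → ∀ u v : ℕ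 → ℝ, (∀ k, u k ∈ Set.Ioc (0:ℝ) 1) → (∀ k, v k ∈ Set.Ioc (0:ℝ) 1) → Filter.Tendsto u Filter.atTop (nhds 0) → Filter.Tendsto (fun k => u k / v k) Filter.atTop (nhds 1) → ∀ (n : ℕ) (K : Set (Fin n → EuclideanSpace ℝ (Fin 3))), K ⊆ Literature.Probability.LatticeModels.NonCoincident 3 n → IsCompact K → TendstoUniformlyOn (fun k x => Literature.Probability.LatticeModels.rescaledCorrelator (Literature.Probability.LatticeModels.criticalCorr 3) (fun δ : ℝ => (Literature.Probability.LatticeModels.criticalTwoPoint 3 (Pi.single 0 ⌊δ⁻¹⌋)) ^ (-(1/2:ℝ))) n (u k) x - Literature.Probability.LatticeModels.rescaledCorrelator (Literature.Probability.LatticeModels.criticalCorr 3) (fun δ : ℝ => (Literature.Probability.LatticeModels.criticalTwoPoint 3 (Pi.single 0 ⌊δ⁻¹⌋)) ^ (-(1/2:ℝ))) n (v k) x) (fun _ => (0:ℝ)) Filter.atTop K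

/-- item stmt-CriticalPhenomena-4662 · support · rank 9 · open · by planner
sources: AizenmanDuminilCopinAnnals2021 (arXiv:1912.07973 §5.6), DuminilcopinPanis2025 (arXiv:2404.05700 Thm 1.5), Literature.Probability.LatticeModels.HasIsingEtaBounds
[support] two-sided pure-power bounds c‖x‖^{-(1+η)} ≤ ⟨σ₀σ_x⟩_{β_c(3)} ≤ C‖x‖^{-(1+η)} for some η
(HasIsingEtaBounds 3 η). Lattice partial engine for ClusterSetTotallyDisconnected: under it every
scale-covariant cluster point has exponent exactly Δ = (1+η)/2 (λ^{-2(Δ_S−Δ)} ∈ [c/C, C/c] for all λ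
> 0 forces Δ_S = Δ), so 𝒞 can only wander at FIXED two-point function. The log-sense exponent of
item 0635 (HasIsingExponentEta) does NOT suffice: g(n) = n^{-2a}·exp(c·√(log n)·sin √(log n)) has η
= 2a−1 yet a whole interval of pure-power cluster exponents. = output (D2) of card
every-scale-regular-multiplicative-fekete; 'under the power-law assumption every scale is regular …
no unconditional proof' (ADC21 §5.6). [difficulty: open-problem] -/
@[route_item "route-CriticalPhenomena-ClusterRigidity", crux]
def DimensionPinned : Prop :=
  ∃ η : ℝ, Literature.Probability.LatticeModels.HasIsingEtaBounds 3 η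

/-- item stmt-CriticalPhenomena-4663 · assembly · rank 1 · open · by planner
sources: Literature.Barriers.CriticalPhenomena.hasPointwiseScalingLimit_of_seq_subseq, Literature.Barriers.CriticalPhenomena.hasConformalLimit_of_compact_of_unique, Literature.Probability.LatticeModels.criticalTwoPoint_bounds_holds
[assembly] UniformRegularity → ClusterPointsMoebius → ClusterSetTotallyDisconnected → NonGaussian →
Ising3DConformalLimit (texts inlined so that the shared item's decl name cannot break the file). -/
@[route_item "route-CriticalPhenomena-ClusterRigidity", crux]
def Assembly : Prop :=
  ((∀ (n : ℕ) (K : Set (Fin n → EuclideanSpace ℝ (Fin 3))), K ⊆ Literature.Probability.LatticeModels.NonCoincident 3 n → IsCompact K → (∃ M δ₀ : ℝ, 0 < δ₀ ∧ ∀ δ ∈ Set.Ioo 0 δ₀, ∀ x ∈ K, |Literature.Probability.LatticeModels.rescaledCorrelator (Literature.Probability.LatticeModels.criticalCorr 3) (fun δ : ℝ => (Literature.Probability.LatticeModels.criticalTwoPoint 3 (Pi.single 0 ⌊δ⁻¹⌋)) ^ (-(1/2:ℝ))) n δ x| ≤ M) ∧ (∀ ε : ℝ, 0 < ε → ∃ r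 δ₀ : ℝ, 0 < r ∧ 0 < δ₀ ∧ ∀ δ ∈ Set.Ioo 0 δ₀, ∀ x ∈ K, ∀ y ∈ K, dist x y < r → |Literature.Probability.LatticeModels.rescaledCorrelator (Literature.Probability.LatticeModels.criticalCorr 3) (fun δ : ℝ => (Literature.Probability.LatticeModels.criticalTwoPoint 3 (Pi.single 0 ⌊δ⁻¹⌋)) ^ (-(1/2:ℝ))) n δ x - Literature.Probability.LatticeModels.rescaledCorrelator (Literature.Probability.LatticeModels.criticalCorr 3) (fun δ : ℝ => (Literature.Probability.LatticeModels.criticalTwoPoint 3 (Pi.single 0 ⌊δ⁻¹⌋)) ^ (-(1/2:ℝ))) n δ y| < ε)) ∧ (∀ K : Set (Fin 2 → EuclideanSpace ℝ (Fin 3)), K ⊆ Literature.Probability.LatticeModels.NonCoincident 3 2 → IsCompact K → ∃ m δ₀ : ℝ, 0 < m ∧ 0 < δ₀ ∧ ∀ δ ∈ Set.Ioo 0 δ₀, ∀ x ∈ K, m ≤ Literature.Probability.LatticeModels.rescaledCorrelator (Literature.Probability.LatticeModels.criticalCorr 3) (fun δ : ℝ => (Literature.Probability.LatticeModels.criticalTwoPoint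 3 (Pi.single 0 ⌊δ⁻¹⌋)) ^ (-(1/2:ℝ))) 2 δ x)) → (∀ S : Literature.Probability.LatticeModels.CorrFamily 3, ((∀ n x, x ∉ Literature.Probability.LatticeModels.NonCoincident 3 n → S n x = 0) ∧ ∃ u : ℕ → ℝ, (∀ k, u k ∈ Set.Ioc (0:ℝ) 1) ∧ Filter.Tendsto u Filter.atTop (nhds 0) ∧ ∀ n, TendstoLocallyUniformlyOn (fun k => Literature.Probability.LatticeModels.rescaledCorrelator (Literature.Probability.LatticeModels.criticalCorr 3) (fun δ : ℝ => (Literature.Probability.LatticeModels.criticalTwoPoint 3 (Pi.single 0 ⌊δ⁻¹⌋)) ^ (-(1/2:ℝ))) n (u k)) (S n) Filter.atTop (Literature.Probability.LatticeModels.NonCoincident 3 n)) → ∃ Δ : ℝ, 0 < Δ ∧ Literature.Probability.LatticeModels.IsMoebiusCovariant Δ S) → (IsTotallyDisconnected {S : Literature.Probability.LatticeModels.CorrFamily 3 | (∀ n x, x ∉ Literature.Probability.LatticeModels.NonCoincident 3 n → S n x = 0) ∧ ∃ u : ℕ → ℝ, (∀ k, u k ∈ Set.Ioc (0:ℝ)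 1) ∧ Filter.Tendsto u Filter.atTop (nhds 0) ∧ ∀ n, TendstoLocallyUniformlyOn (fun k => Literature.Probability.LatticeModels.rescaledCorrelator (Literature.Probability.LatticeModels.criticalCorr 3) (fun δ : ℝ => (Literature.Probability.LatticeModels.criticalTwoPoint 3 (Pi.single 0 ⌊δ⁻¹⌋)) ^ (-(1/2:ℝ))) n (u k)) (S n) Filter.atTop (Literature.Probability.LatticeModels.NonCoincident 3 n)}) → (∀ (ρ : ℝ → ℝ) (S : Literature.Probability.LatticeModels.CorrFamily 3), (∀ δ ∈ Set.Ioc (0:ℝ) 1, 0 < ρ δ) → Literature.Probability.LatticeModels.HasPointwiseScalingLimit (Literature.Probability.LatticeModels.criticalCorr 3) ρ S → Literature.Probability.LatticeModels.IsNondegenerateTwoPoint S → Literature.Probability.LatticeModels.HasNontrivialU4 S) → Ising3DConformalLimit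

/-! D-0027 §2.1 — DECIDING THEOREM (planner-authored via `route open/edit --closes-file`; by planner-rbadge-CriticalPhenomena-ClusterRigidi-e00e0ea9-g4-0 2026-08-15T16:08:53Z):
its hypotheses are this route's items and its conclusion the sub-problem Statement (glue_lint), and it elaborates with this file. -/

@[closes "route-CriticalPhenomena-ClusterRigidity"] theorem closes : ClusterPointsMoebius → UniformRegularity → ClusterSetTotallyDisconnected → NonGaussian → Precompactness → AsymptoticContinuity → DimensionPinned → Assembly → _root_.Ising3DConformalLimit :=
  fun h_ClusterPointsMoebius h_UniformRegularity h_ClusterSetTotallyDisconnected h_NonGaussian _h_Precompactness _h_AsymptoticContinuity _h_DimensionPinned h_Assembly =>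
    h_Assembly h_UniformRegularity h_ClusterPointsMoebius h_ClusterSetTotallyDisconnected h_NonGaussian

end Summit.CriticalPhenomena.Ising3DConformalLimit.Theses.ClusterRigidity
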